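import Summits.ResolutionOfSingularities.ResolutionOfSingularities.Theorems.FrobeniusLadderFInjectiveMacaulayficationRMonoidSpanning
import HarnessLib

/-!
# T-TOR IN-HOUSE for the recurrent-monoid bed, (FREE′) half 2a: the HALF-OPEN CONE DECOMPOSITION and injectivity of `Ψ_t` degree by degree
# (crux `FInjectiveMacaulayfication` stmt-ResolutionOfSingularities-15315, chain w45a; res-L1-w45a-plan-1 R23.13 (2) + GO 06:28:28Z «(CM) = (FREE′)»;
# seat res-L1-w45a-lead-1 g13; data `…RMonoidFreeDefs`, spanning `…RMonoidSpanning`)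

[OURS · L1 W4.5a] Support file (`--supports stmt-ResolutionOfSingularities-15315 --as helper`); def-free; UNCONDITIONAL; no named fact; NOT a statement
of any manuscript; replaces the role of NO printed item. AI-written (AI review is weaker than expert review). Nothing of the crux is proved here.

THE COUNT. For `t : ℕ` let `I_t = {(i, a) : a ∈ ℕ⁴, |a| + bDeg i = t}` and `Ψ_t : k^{I_t} → k[R]`, `e_{(i,a)} ↦ θ^a · bElem i`; its image is
`M_t = span_k {θ^a · bElem i : |a| + bDeg i = t}`, which by ✓`RMonoidSpanning.wordElem_wordOf_mem` contains every monomial of degree `t`.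
* §1 `conePoint_i`, `wordExp_conePoint_i`, `sum_conePoint` — the lattice points `bMult i + Σ a_s e_{coneGen i s}` of the five half-open unimodular
  cones (`RMonoidFreeDefs.coneGen`; lead-1 g13 `comp/dcd.py`) and their exponents / degrees;
* §2 ★ `conePoint_injective` — `(i, a) ↦ exponent` is INJECTIVE (pairwise disjointness of the half-open cones + unimodularity; 25 `omega` cases):
  so the monomials `wordElem (wordOf (conePoint i a))`, `(i,a) ∈ I_t`, are `#I_t` DISTINCT monomials of degree `t`, all inside `M_t`;
* §3 ★★ `psi_injective` — hence `dim_k M_t ≥ #I_t` while `Ψ_t` is onto `M_t`: rank–nullity makes `Ψ_t` INJECTIVE, i.e. a `k[θ]`-relation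
  `Σᵢ gᵢ(θ) · bElem i = 0` with `gᵢ` homogeneous of degree `t − bDeg i` has all `gᵢ = 0`. (All degrees at once, and the `k[Y]`-basis / `Module.Free`
  packaging: `…RMonoidFreeBasis`.)
[folklore; cite: BrunsHerzog1998, Thm. 2.1.2 (context); Stanley1982 (context: half-open decompositions)]
-/

-- single-problem summit: the doubled namespace component is forced
set_option linter.dupNamespace false

noncomputable section

open MvPolynomial

namespace Summit.ResolutionOfSingularities.ResolutionOfSingularities.Theorems.FInjectiveMacaulayfication.RMonoidDegreeCount

open Summit.ResolutionOfSingularities.ResolutionOfSingularities.Theorems.FInjectiveMacaulayfication RMonoidFreeDefs RMonoidStraightening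
  RMonoidSpanning
open Summit.ResolutionOfSingularities.ResolutionOfSingularities.Theorems.WildQuotientResolution.ToricChart

variable (k : Type) [Field k]

/-! ## §1 The half-open cones -/

/-- The `0`-th half-open cone's lattice points, as multiplicity vectors. [OURS · computation] -/
theorem conePoint_0 (a : Fin 4 → ℕ) : conePoint 0 a = ![a 0, a 1, a 2, 0, 0, a 3, 0] := by
  funext j; fin_cases j <;> simp [conePoint, coneGen, bMult, Fin.sum_univ_four]

/-- The `1`-th half-open cone's lattice points, as multiplicity vectors. [OURS · computation] -/
theorem conePoint_1 (a : Fin 4 → ℕ) : conePoint 1 a = ![a 0, a 1, 0, 0, 0, a 2, 1 + a 3] := by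
  funext j; fin_cases j <;> simp [conePoint, coneGen, bMult, Fin.sum_univ_four]

/-- The `2`-th half-open cone's lattice points, as multiplicity vectors. [OURS · computation] -/
theorem conePoint_2 (a : Fin 4 → ℕ) : conePoint 2 a = ![0, a 0, a 1, 1 + a 2, 0, a 3, 0] := by
  funext j; fin_cases j <;> simp [conePoint, coneGen, bMult, Fin.sum_univ_four]

/-- The `3`-th half-open cone's lattice points, as multiplicity vectors. [OURS · computation] -/
theorem conePoint_3 (a : Fin 4 → ℕ) : conePoint 3 a = ![0, a 0, 0, 1 + a 1, 0, a 2, 1 + a 3] := by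
  funext j; fin_cases j <;> simp [conePoint, coneGen, bMult, Fin.sum_univ_four]

/-- The `4`-th half-open cone's lattice points, as multiplicity vectors. [OURS · computation] -/
theorem conePoint_4 (a : Fin 4 → ℕ) : conePoint 4 a = ![0, 0, a 0, a 1, 1 + a 2, a 3, 0] := by
  funext j; fin_cases j <;> simp [conePoint, coneGen, bMult, Fin.sum_univ_four]

/-- Exponent of the `0`-th cone's points. [OURS · computation] -/
theorem wordExp_conePoint_0 (a : Fin 4 → ℕ) :
    wordExp RMonoidDefs.rDatum (wordOf (conePoint 0 a)) = ![a 0 + a 3, a 3, a 1, a 2 + a 3] := by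
  rw [conePoint_0, wordExp_wordOf]
  funext s; fin_cases s <;> simp

/-- Exponent of the `1`-th cone's points. [OURS · computation] -/
theorem wordExp_conePoint_1 (a : Fin 4 → ℕ) :
    wordExp RMonoidDefs.rDatum (wordOf (conePoint 1 a)) = ![a 0 + a 2 + 1 + a 3, a 2 + 1 + a 3, a 1 + 1 + a 3, a 2] := by
  rw [conePoint_1, wordExp_wordOf]
  funext s; fin_cases s <;> simp <;> ring

/-- Exponent of the `2`-th cone's points. [OURS · computation] -/
theorem wordExp_conePoint_2 (a : Fin 4 → ℕ) :
    wordExp RMonoidDefs.rDatum (wordOf (conePoint 2 a)) = ![a 3, 1 + a 2 + a 3, a 0 + 1 + a 2, a 1 + 1 + a 2 + a 3] := by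
  rw [conePoint_2, wordExp_wordOf]
  funext s; fin_cases s <;> simp <;> ring

/-- Exponent of the `3`-th cone's points. [OURS · computation] -/
theorem wordExp_conePoint_3 (a : Fin 4 → ℕ) :
    wordExp RMonoidDefs.rDatum (wordOf (conePoint 3 a)) = ![a 2 + 1 + a 3, 1 + a 1 + a 2 + 1 + a 3, a 0 + 1 + a 1 + 1 + a 3, 1 + a 1 + a 2] := by
  rw [conePoint_3, wordExp_wordOf]
  funext s; fin_cases s <;> simp <;> ring

/-- Exponent of the `4`-th cone's points. [OURS · computation] -/
theorem wordExp_conePoint_4 (a : Fin 4 → ℕ) :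
    wordExp RMonoidDefs.rDatum (wordOf (conePoint 4 a)) = ![a 3, a 1 + 1 + a 2 + a 3, a 1, a 0 + a 1 + 2 * (1 + a 2) + a 3] := by
  rw [conePoint_4, wordExp_wordOf]
  funext s; fin_cases s <;> simp
  ring

/-- `Σ_j bMult i j = bDeg i`. [OURS · computation] -/
theorem sum_bMult (i : Fin 5) : ∑ j, bMult i j = bDeg i := by
  fin_cases i <;> rfl

/-- Degree of a cone point: `Σ_j conePoint i a j = |a| + bDeg i`. [OURS · computation] -/
theorem sum_conePoint (i : Fin 5) (a : Fin 4 → ℕ) : ∑ j, conePoint i a j = (∑ s, a s) + bDeg i := by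
  simp only [conePoint, Finset.sum_add_distrib, sum_bMult]
  rw [Finset.sum_comm, add_comm]
  congr 1
  exact Finset.sum_congr rfl fun s _ => by rw [Finset.sum_ite_eq]; simp

/-! ## §2 Disjointness: `(i, a) ↦ exponent of the cone point` is injective -/

attribute [local simp] wordExp_conePoint_0 wordExp_conePoint_1 wordExp_conePoint_2 wordExp_conePoint_3 wordExp_conePoint_4

/-- ★ **The half-open cones are pairwise disjoint and each is unimodular**: the exponent of `conePoint i a` determines `(i, a)`.
[OURS · L1 W4.5a; lead-1 g13 `comp/dcd.py` (generic interior vector)] -/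
theorem conePoint_injective (i i' : Fin 5) (a a' : Fin 4 → ℕ)
    (h : wordExp RMonoidDefs.rDatum (wordOf (conePoint i a)) = wordExp RMonoidDefs.rDatum (wordOf (conePoint i' a'))) :
    i = i' ∧ a = a' := by
  have h0 := congrFun h 0
  have h1 := congrFun h 1
  have h2 := congrFun h 2
  have h3 := congrFun h 3
  fin_cases i <;> fin_cases i' <;>
    (simp at h0 h1 h2 h3
     first
      | (exfalso; omega)
      | exact ⟨rfl, funext fun s => by fin_cases s <;> simp <;> omega⟩)

/-- `θ` of a cone-point monomial is the monomial with exponent `ιexp (wordExp …)`. [plumbing] -/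
theorem theta_wordElem_wordOf (m : Fin 7 → ℕ) :
    theta (wordElem k PEmpty RMonoidDefs.rDatum (wordOf m)) = monomial (ιexp PEmpty (wordExp RMonoidDefs.rDatum (wordOf m))) 1 := by
  rw [theta_wordElem, xmon_eq_monomial]

/-! ## §3 `Ψ_t` is injective: a homogeneous `k[θ]`-relation among the `bElem i` is trivial -/

/-- `Finsupp.degree` over `Fin 4` is the plain sum. [plumbing] -/
theorem sum_eq_of_mem_support_isHomogeneous {n : ℕ} {g : MvPolynomial (Fin 4) k} (hg : g.IsHomogeneous n) {a : Fin 4 →₀ ℕ}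
    (ha : a ∈ g.support) : ∑ s, a s = n := by
  have h := hg (mem_support_iff.mp ha)
  rw [Finsupp.weight_apply] at h
  simpa [Finsupp.sum_fintype] using h

/-- `aeval θ g · bElem i` as a sum over the support of `g`. [plumbing] -/
theorem aeval_mul_bElem_eq_sum (g : MvPolynomial (Fin 4) k) (i : Fin 5) :
    MvPolynomial.aeval (thetaFun k) g * bElem k i = ∑ a ∈ g.support, coeff a g • (thetaPow k ⇑a * bElem k i) := by
  rw [MvPolynomial.aeval_def, MvPolynomial.eval₂_eq', Finset.sum_mul]
  refine Finset.sum_congr rfl fun a _ => ?_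
  rw [Algebra.smul_def, mul_assoc]
  rfl

/-- ★★ **`Ψ_t` is injective.** If `g : Fin 5 → k[Y₀..Y₃]` has `g i` homogeneous of degree `t − bDeg i` (and `g i = 0` when `t < bDeg i`) and
`Σᵢ gᵢ(θ) · bElem i = 0` in `k[R]`, then every `g i = 0`. Proof: `Ψ_t : k^{I_t} → M_t` is onto (spanning) and `M_t` contains the `#I_t` distinct
monomials `wordElem (wordOf (conePoint i a))`, so `dim M_t ≥ #I_t` and `Ψ_t` is injective by rank–nullity; the relation is `Ψ_t` of the coefficient
vector of `g`. [OURS · L1 W4.5a] -/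
theorem psi_injective (t : ℕ) (g : Fin 5 → MvPolynomial (Fin 4) k) (hhom : ∀ i, (g i).IsHomogeneous (t - bDeg i))
    (hlow : ∀ i, t < bDeg i → g i = 0) (hrel : ∑ i, MvPolynomial.aeval (thetaFun k) (g i) * bElem k i = 0) : ∀ i, g i = 0 := by
  classical
  -- the index set `I_t`
  set J : Fin 5 → Finset (Fin 4 →₀ ℕ) := fun i =>
    if bDeg i ≤ t then (Finset.Nat.antidiagonalTuple 4 (t - bDeg i)).map (Finsupp.equivFunOnFinite.symm.toEmbedding) else ∅ with hJ
  have memJ : ∀ i a, a ∈ J i ↔ (∑ s, a s) + bDeg i = t := by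
    intro i a
    simp only [hJ]
    split_ifs with hle
    · rw [Finset.mem_map]
      constructor
      · rintro ⟨b, hb, rfl⟩
        rw [Finset.Nat.mem_antidiagonalTuple] at hb
        simp only [Equiv.toEmbedding_apply, Finsupp.coe_equivFunOnFinite_symm]
        omega
      · intro ha
        refine ⟨⇑a, Finset.Nat.mem_antidiagonalTuple.mpr (by omega), ?_⟩
        simp
    · simp only [Finset.notMem_empty, false_iff]
      omega
  set I : Finset (Σ _ : Fin 5, Fin 4 →₀ ℕ) := Finset.univ.sigma J with hI
  have memI : ∀ x, x ∈ I ↔ (∑ s, x.2 s) + bDeg x.1 = t := fun x => by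
    rw [hI, Finset.mem_sigma]; simp only [Finset.mem_univ, true_and]; exact memJ x.1 x.2
  -- the family `v` and its span `M_t`
  set v : ↥I → Ring k PEmpty RMonoidDefs.rDatum := fun x => thetaPow k ⇑x.1.2 * bElem k x.1.1 with hv
  set M : Submodule k (Ring k PEmpty RMonoidDefs.rDatum) := Submodule.span k (Set.range v) with hM
  haveI : Module.Finite k M := FiniteDimensional.span_of_finite k (Set.finite_range v)
  -- `M_t` (inline form of the spanning file) is contained in `M`
  have hMle : Submodule.span k {x | ∃ (i : Fin 5) (a : Fin 4 → ℕ), (∑ s, a s) + bDeg i = t ∧ x = thetaPow k a * bElem k i} ≤ M := by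
    refine Submodule.span_le.mpr ?_
    rintro x ⟨i, a, ha, rfl⟩
    have hmem : (⟨i, Finsupp.equivFunOnFinite.symm a⟩ : Σ _ : Fin 5, Fin 4 →₀ ℕ) ∈ I := by
      rw [memI]; simpa using ha
    refine Submodule.subset_span ⟨⟨_, hmem⟩, ?_⟩
    simp [hv]
  -- the competing independent family: distinct monomials of degree `t` inside `M`
  set W : ↥I → Ring k PEmpty RMonoidDefs.rDatum := fun x => wordElem k PEmpty RMonoidDefs.rDatum (wordOf (conePoint x.1.1 ⇑x.1.2)) with hW
  have hWmem : ∀ x, W x ∈ M := fun x =>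
    hMle (wordElem_wordOf_mem k t _ (by rw [sum_conePoint]; exact (memI x.1).mp x.2))
  have hWind : LinearIndependent k W := by
    have hcomp : (theta (k := k) (P := PEmpty) (D := RMonoidDefs.rDatum)).toLinearMap ∘ W =
        (fun μ : (Fin 4 ⊕ PEmpty) →₀ ℕ => monomial μ (1 : k)) ∘
          fun x : ↥I => ιexp PEmpty (wordExp RMonoidDefs.rDatum (wordOf (conePoint x.1.1 ⇑x.1.2))) := by
      funext x
      exact theta_wordElem_wordOf k _
    refine LinearIndependent.of_comp (theta (k := k) (P := PEmpty) (D := RMonoidDefs.rDatum)).toLinearMap ?_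
    rw [hcomp]
    refine (coe_basisMonomials (Fin 4 ⊕ PEmpty) k ▸ (basisMonomials (Fin 4 ⊕ PEmpty) k).linearIndependent).comp _ ?_
    intro x y hxy
    obtain ⟨⟨i, a⟩, hx⟩ := x
    obtain ⟨⟨i', a'⟩, hy⟩ := y
    have h1 : wordExp RMonoidDefs.rDatum (wordOf (conePoint i ⇑a)) = wordExp RMonoidDefs.rDatum (wordOf (conePoint i' ⇑a')) := by
      have := congrArg dist hxy
      rwa [dist_ιexp, dist_ιexp] at this
    obtain ⟨hi, ha⟩ := conePoint_injective i i' _ _ h1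
    subst hi
    have ha' : a = a' := DFunLike.coe_injective ha
    subst ha'
    rfl
  have hcard : Fintype.card ↥I ≤ Module.finrank k M := by
    have hW' : LinearIndependent k (fun x : ↥I => (⟨W x, hWmem x⟩ : M)) :=
      LinearIndependent.of_comp M.subtype (by exact hWind)
    exact hW'.fintype_card_le_finrank
  -- `Ψ_t`, onto `M`
  set Ψ : (↥I → k) →ₗ[k] Ring k PEmpty RMonoidDefs.rDatum := Fintype.linearCombination k v with hΨ
  have hΨmem : ∀ c, Ψ c ∈ M := fun c => by
    rw [hM, ← Fintype.range_linearCombination]; exact LinearMap.mem_range_self _ c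
  set Ψ' : (↥I → k) →ₗ[k] M := Ψ.codRestrict M hΨmem with hΨ'
  have hsurj : LinearMap.range Ψ' = ⊤ := by
    rw [LinearMap.range_eq_top]
    rintro ⟨y, hy⟩
    have hy' : y ∈ LinearMap.range Ψ := by rw [hΨ, Fintype.range_linearCombination]; exact hy
    obtain ⟨c, hc⟩ := hy'
    exact ⟨c, Subtype.ext hc⟩
  have hker : LinearMap.ker Ψ' = ⊥ := by
    have h1 := LinearMap.finrank_range_add_finrank_ker Ψ'
    rw [hsurj, finrank_top, Module.finrank_pi] at h1
    rw [← Submodule.finrank_eq_zero]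
    omega
  have hinjΨ : Function.Injective Ψ := by
    intro c₁ c₂ h12
    have : Ψ' c₁ = Ψ' c₂ := Subtype.ext h12
    exact LinearMap.ker_eq_bot.mp hker this
  -- the coefficient vector of `g` and its image under `Ψ_t`
  set c : ↥I → k := fun x => coeff x.1.2 (g x.1.1) with hc
  have hsupp : ∀ i, (g i).support ⊆ J i := by
    intro i a ha
    rw [memJ]
    by_cases hle : bDeg i ≤ t
    · have := sum_eq_of_mem_support_isHomogeneous k (hhom i) ha
      omega
    · exfalso
      rw [hlow i (by omega)] at ha
      simp at ha
  have hΨc : Ψ c = ∑ i, MvPolynomial.aeval (thetaFun k) (g i) * bElem k i := by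
    rw [hΨ, Fintype.linearCombination_apply]
    rw [show (∑ x : ↥I, c x • v x) = ∑ x ∈ I, coeff x.2 (g x.1) • (thetaPow k ⇑x.2 * bElem k x.1) from
      Finset.sum_coe_sort I (fun x => coeff x.2 (g x.1) • (thetaPow k ⇑x.2 * bElem k x.1))]
    rw [hI, Finset.sum_sigma]
    refine Finset.sum_congr rfl fun i _ => ?_
    rw [aeval_mul_bElem_eq_sum]
    exact (Finset.sum_subset (hsupp i) fun a _ ha => by rw [notMem_support_iff.mp ha, zero_smul]).symm
  have hc0 : c = 0 := hinjΨ (by rw [hΨc, hrel, map_zero])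
  intro i
  ext a
  rw [coeff_zero]
  by_cases ha : a ∈ (g i).support
  · have hx : (⟨i, a⟩ : Σ _ : Fin 5, Fin 4 →₀ ℕ) ∈ I := by rw [hI, Finset.mem_sigma]; exact ⟨Finset.mem_univ _, hsupp i ha⟩
    have := congrFun hc0 ⟨⟨i, a⟩, hx⟩
    simpa [hc] using this
  · exact notMem_support_iff.mp ha

end Summit.ResolutionOfSingularities.ResolutionOfSingularities.Theorems.FInjectiveMacaulayfication.RMonoidDegreeCount

end
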